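import Literature.NumberTheory.EllipticCurves.Kato2004.AdmissibleZetaClassNonvanishingProofs
import Literature.NumberTheory.EllipticCurves.TateModuleFreeProofs
import Summits.BirchSwinnertonDyer.BirchSwinnertonDyer.Theorems.CyclotomicUntwistRohrlichAtLevel
import HarnessLib

/-!
# Crux `DerivedKatoDoor` (stmt-BirchSwinnertonDyer-23024), line `lower`: the stub `stub_admissibleNeZero`
# — «every admissible Kato zeta class is NON-ZERO», UNCONDITIONALLY (Kato Thm. 12.5 via Rohrlich)

Route `DerivedKatoValuationDoor` (BSD is not proved by any of this). Registered stub of the lead's line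
`Cruxes/DerivedKatoDoor/Lines/lower.lean` (revision 4): for EVERY elliptic `W/ℚ` (global minimal model),
EVERY prime `p`, every `ℤ_p`-extension datum `K` (with `hK : K.IsCyclotomic`), topological generator `γ`,
pinned Iwasawa cohomology `I : Kato2004.IwasawaH1Data W p K γ` and `z₀ ∈ I.H`:

  `IsAdmissibleZetaClass W p K hK I z₀ ⟹ z₀ ≠ 0`.

No door hypothesis is needed. The three inputs are ALL tree theorems: (i) the tree's reading of Kato's
Thm. 12.5 (1) «[Ro1] ⇒ the zeta element is not zero» for admissible classes,
`Kato2004.IsAdmissibleZetaClass.ne_zero_of_rohrlich` (file `AdmissibleZetaClassNonvanishingProofs`),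
whose one hypothesis is Rohrlich's finiteness of vanishing twists of `p`-power conductor for the newform
of `W`; (ii) that finiteness for ANY prime `p`, `PSRohrlichAtLevel.rohrlich_primePow_of_isNewformOf`
(cell bsd-potss, Rohrlich 1984/1989, proved in tree from Hasse bounds + Atkin–Lehner); (iii) the Tate
module of an elliptic curve is finite free over `ℤ_p` (`WeierstrassCurve.module_free_tateModule_holds`,
`module_finite_tateModule_holds`, Silverman AEC III.7.1, proved in tree). So the «`z₀ ≠ 0`» half of the
line's print stub is discharged outright and the print stub shrinks to the pure Iwasawa-main-conjecture
inequality `ℓ_T(𝐇¹/Λz₀) ≤ ℓ_T(X₀(E/ℚ_∞))`.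

References: K. Kato, Astérisque 295 (2004), Thm. 12.5 (1) and its proof (pp. 221–222) [Kato2004Asterisque];
D. Rohrlich, Invent. Math. 75 (1984) 409–423, Theorem p. 409; Invent. Math. 97 (1989) [RohrlichInventiones1984];
J. Silverman, AEC (2009), Prop. III.7.1 [SilvermanAEC2009].
-/

-- D-0017: single-problem summit, so `Summit.BirchSwinnertonDyer.BirchSwinnertonDyer.…` repeats a
-- namespace BY DESIGN.
set_option linter.dupNamespace false

noncomputable section

namespace Summit.BirchSwinnertonDyer.BirchSwinnertonDyer.Theorems

open Literature.NumberTheory.EllipticCurves Literature.NumberTheory.EllipticCurves.Kato2004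

/-- **Stub `stub_admissibleNeZero` of line `lower` of crux `DerivedKatoDoor` (stmt-BirchSwinnertonDyer-23024),
PROVED: every admissible Kato zeta class of every pinned `𝐇¹_Γ(T_pW)` is non-zero** — for every elliptic
`W/ℚ` (global minimal model), prime `p`, `ℤ_p`-extension datum `K`, `hK : K.IsCyclotomic`, `γ`, `I`,
`z₀`: `K.IsTopGenerator γ → IsAdmissibleZetaClass W p K hK I z₀ → z₀ ≠ 0`. Proof: Kato Thm. 12.5 (1)
(`IsAdmissibleZetaClass.ne_zero_of_rohrlich`) fed with Rohrlich's theorem at any `p`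
(`PSRohrlichAtLevel.rohrlich_primePow_of_isNewformOf`) and `T_pW` finite free over `ℤ_p`
(`module_free_tateModule_holds`, `module_finite_tateModule_holds`). The registered signature, verbatim.
[cite: Kato2004Asterisque, Thm. 12.5 (1) and proof (pp. 221–222)] [cite: RohrlichInventiones1984, Theorem (p. 409)]
[cite: SilvermanAEC2009, Prop. III.7.1] -/
theorem stub_admissibleNeZero :
    ∀ (W : WeierstrassCurve ℚ) [W.IsElliptic] [W.IsGloballyMinimal] (p : ℕ) [Fact p.Prime]
      [ContinuousSMul ℤ_[p] (W.tateModule p)]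
      (K : Literature.NumberTheory.EllipticCurves.ZpExtension ℚ p) (hK : K.IsCyclotomic)
      (γ : Field.absoluteGaloisGroup ℚ)
      (I : Literature.NumberTheory.EllipticCurves.Kato2004.IwasawaH1Data W p K γ) (z₀ : I.H),
      K.IsTopGenerator γ →
      Literature.NumberTheory.EllipticCurves.Kato2004.IsAdmissibleZetaClass W p K hK I z₀ → z₀ ≠ 0 := by
  intro W _ _ p _ _ K hK γ I z₀ hγ hz
  haveI : Module.Free ℤ_[p] (W.tateModule p) := W.module_free_tateModule_holds p
  haveI : Module.Finite ℤ_[p] (W.tateModule p) := W.module_finite_tateModule_holds p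
  exact hz.ne_zero_of_rohrlich hγ fun hf => PSRohrlichAtLevel.rohrlich_primePow_of_isNewformOf hf

end Summit.BirchSwinnertonDyer.BirchSwinnertonDyer.Theorems

end
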